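import Literature.AlgebraicGeometry.ShimuraVarieties.UnitaryCurveSpecialPairReciprocity
import Literature.AlgebraicGeometry.ShimuraVarieties.UnitaryCurveSpecialPairOfAuxComplexStructure
import Literature.AlgebraicGeometry.ModuliOfAbelianVarieties.SiegelCMSpecialPairMover
import HarnessLib

/-!
# The Siegel reciprocity datum of a special point of the unitary Shimura curve, MOVED to the chart's complex structure `q⁻¹ • J(ι₁ w)`

Topic `AlgebraicGeometry/ShimuraVarieties`; namespace `Literature.AlgebraicGeometry.ShimuraVarieties.UnitaryCurve.AuxV`.  THEOREMS ONLY (no `def`,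
no named fact, no instance, no notation, no `sorry`).  Sequel of ★ E3R-U `UnitaryCurveSpecialPairReciprocity` (`exists_sliceField_siegelRecipDatum`),
★ `UnitaryCurveSpecialPairOfAuxComplexStructure` (`isSpecial_auxComplexStructureV_curve`) and ★ `ModuliOfAbelianVarieties/SiegelCMSpecialPairMover`.
Cell `hodgecm-mathlib` (D-0151), FLOOR 0, P6 «MOD», line L6 = the Σ-GAL half of `stub_E6` (E-line `Cruxes/HLiu418/Lines/F0_P6a_PELWitnessE.lean`),
organ (K-a) «CM STRUCTURE SPECIAL AT `⟨jOfSiegel (Z a v), _⟩` VIA THE MOVER»; `--supports stmt-HodgeConjecture-24832`, count-neutral; HC_CM is proved only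
modulo the printed citations (2 remaining named inputs hLiu418 24832, h413 24833) until rung 0 closes.

WHY.  The Σ-GAL socket (`ReadsCReading → ReadsCGalois`, A-p06's closer v7 ∕ A-p04's `SigmaGAL.skeleton`) feeds the CM conjugation hom of
★ `MumfordModuli.CMConjugationIsogenyAll` into the KERNEL ★ `SiegelAdelicMarking.conjugate_comp_conjFibreIso_eq_of_lifts_of_hom`; the kernel's markings
`m₁` sit at the complex structure `J(C.Z a v) = (q a)_ℝ⁻¹ · J(v) · (q a)_ℝ` of the MOVER LAW (★ `UnitaryCurve.exists_siegelChartGS_mover` clause (Q) =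
`AuxChartGS.q_spec`), whereas the curve's CM special pair and its reciprocity datum (★ E3R-U) sit at `J(ι₁ w)`.  This file delivers the E3R-U datum AT THE
MOVED STRUCTURE `J′` for any `q ∈ GSp_δ(ℚ)` with `q_ℝ⁻¹ J(ι₁w) q_ℝ = J′`:
* §1 `exists_sliceField_siegelRecipDatum_mover` — E3R-U's head with its special-pair clause `hJsp` BY VALUE (general Hodge-embedding datum `J`), conclusion
  at `J′`: `(c′, J′)` special with types `Φ′`, `E*(Φ′ᵢ) ⊆ E ⊆ E₀`, `s♯` an Artin correspondent of `σ` over `E`, `r′ ∈ GSp_δ(𝔸_f)` with matrix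
  `c′.cmRecipMatrix Φ′ E s♯` — the `hsp hE σ s hs r hr` block of ★ `CMConjugationIsogenyAll` VERBATIM — and the class identities
  `[J′, r′·(q_𝔸⁻¹ũ(a,1))]_{K_δ(N)} = [J′, q_𝔸⁻¹ũ(d♯a,1)]_{K_δ(N)}`, `[ι₁w, d·a]_K = [ι₁w, d♯·a]_K`;
* §2 `exists_sliceField_siegelRecipDatum_curve` ∕ `exists_sliceField_siegelRecipDatum_curve_mover` — the same at Deligne's `J = J_Φ` of the curve (E2's
  `auxComplexStructureV`), the special-pair clause DISCHARGED by ★ `isSpecial_auxComplexStructureV_curve` (un-moved: the constructor-at-birth of the E-line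
  ED. 5 field carrying the CM datum; moved: its form at the chart's `J(Z a v)`).
Proof: ★ E3R-U ∘ ★ `CMStructure.IsSpecial.exists_inv_conj_recip_of_conjJ_eq` ∘ ★ `SiegelShimuraSet.mk_inv_conj_mul_inv_mul_eq_of_mk_mul_eq`.

## References
* [Deligne1971TravauxShimura] P. Deligne, *Travaux de Shimura* (1971): Déf. 3.13 p. 141, 4.18 p. 150, 5.1 p. 153, 5.11 p. 158.
* [Milne2005ShimuraVarieties] J. S. Milne, *Introduction to Shimura varieties* (2005): §5 p. 57, Def. 12.5 p. 113, Def. 12.8 (59)–(62) p. 114,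
  Rem. 12.9 p. 115, Ex. 12.4 (b) p. 112.
* [RapoportSmithlingZhang2020Diagonal] M. Rapoport, B. Smithling, W. Zhang (2020): Remark 3.1 p. 9, (3.3), (3.10).
-/

set_option autoImplicit false

noncomputable section

open Matrix NumberField IsDedekindDomain

namespace Literature.AlgebraicGeometry.ShimuraVarieties

namespace UnitaryCurve

namespace AuxV

open Literature.AlgebraicGeometry.ModuliOfAbelianVarieties
open Literature.NumberTheory.ComplexMultiplication (traceField)
open Literature.AlgebraicGeometry.Motives (CMType)
open Literature.NumberTheory.Automorphic Literature.NumberTheory.Automorphic.UnitaryGroup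
open Literature.AlgebraicGeometry.ShimuraVarieties.UnitaryCanonicalModel (IsArtinCorrespondent recipFactor IsDiagTwistGS ShimuraSetGS)

variable {F : Type} [Field F] [NumberField F] [IsCMField F]

/-! ### §1. E3R-U's head at the moved complex structure `J′ = q_ℝ⁻¹ · J(ι₁ w) · q_ℝ` -/

/-- **THE SIEGEL RECIPROCITY DATUM OF A SPECIAL POINT, AT THE MOVED COMPLEX STRUCTURE** — ★ `exists_sliceField_siegelRecipDatum` (all hypotheses
VERBATIM: curve datum `(F, ι₁, J⋆, Φ ∋ ι₁)`, frame `Fr`, level `N ≥ 1`, Hodge-embedding datum `J` with `hJC`, special-pair clause `hJsp`) with its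
conclusion MOVED along any rational similitude `q ∈ GSp_δ(ℚ)` to any `J′ ∈ S^±` with `q_ℝ⁻¹ · J(ι₁ w) · q_ℝ = J′` (the E-line's mover law
`AuxChartGS.q_spec`, `J′ = J(Z a v)`): a number field `E₀ ∋ ι₁(F)` such that for every `σ ∈ Aut(ℂ)` fixing `E₀`, Artin correspondent `s`, special `w`,
twist `d` by `r_w(s)`, adelic `a` AND every such `(q, J′)` there are `(E, c′, Φ′, s♯, r′, d♯)` with `(c′, J′)` a CM special pair of types `Φ′`,
`E*(Φ′ᵢ) ⊆ E ⊆ E₀`, `s♯` an Artin correspondent of `σ` over `E ⊂ ℂ`, `r′ ∈ GSp_δ(𝔸_f)` of matrix `c′.cmRecipMatrix Φ′ E s♯`,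
`[J′, r′·(q_𝔸⁻¹·ũ_V(a,1))]_{K_δ(N)} = [J′, q_𝔸⁻¹·ũ_V(d♯·a,1)]_{K_δ(N)}` and `[ι₁w, d·a]_K = [ι₁w, d♯·a]_K` at every level `K`
(`c′ = q⁻¹·c·q`, `r′ = q_𝔸⁻¹ r q_𝔸`: ★ `CMStructure.IsSpecial.exists_inv_conj_recip_of_conjJ_eq`, ★ `SiegelShimuraSet.mk_inv_conj_mul_inv_mul_eq_of_mk_mul_eq`).
[cite: Deligne1971TravauxShimura, Déf. 3.13 p. 141, 5.1 p. 153 and 5.11 p. 158] [cite: Milne2005ShimuraVarieties, Def. 12.8 (59)–(62) p. 114, Rem. 12.9 p. 115]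
[cite: RapoportSmithlingZhang2020Diagonal, Remark 3.1 p. 9 and (3.10)] -/
theorem exists_sliceField_siegelRecipDatum_mover (ι₁ : F →+* ℂ) (Jstar : Matrix (Fin 2) (Fin 2) F)
    (hJ : (Jstar.map (IsCMField.complexConj F))ᵀ = Jstar) (Φ : CMType F) (hΦ : ι₁ ∈ Φ.1) {ξ : F} {g N : ℕ} {δ : Fin g → ℕ}
    (hN : N ≠ 0) (Fr : SymplecticFrameV F (RingHom.id F) Jstar ξ g δ)
    (J : (Fin 2 → ℂ) → Matrix (Fin g ⊕ Fin g) (Fin g ⊕ Fin g) ℝ)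
    (hJC : ∀ v : Fin 2 → ℂ, v ∈ negCone (Jstar.map ι₁) → J v ∈ C0pm δ)
    (hJsp : ∀ (w : Fin 2 → F) (hw : (fun i => ι₁ (w i)) ∈ negCone (Jstar.map ι₁)) (b : GL (Fin 2) F),
      (fun i => (b : Matrix (Fin 2) (Fin 2) F) i 1) = w →
      hermForm (cmConjRingHom F) Jstar (fun i => (b : Matrix (Fin 2) (Fin 2) F) i 0) w = 0 →
      ∀ c : CMStructure g δ (Fin 2) (fun _ => F),
        (∀ (x : Fin 2 → F) (p : Fin 2) (m : F),
          c.act x (Fr.β (m • (b : Matrix (Fin 2) (Fin 2) F) *ᵥ Pi.single p 1)) =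
            Fr.β ((x p * m) • (b : Matrix (Fin 2) (Fin 2) F) *ᵥ Pi.single p 1)) →
        ∀ Φ' : Fin 2 → CMType F, Φ' 0 = Φ →
          (∀ ρ : F →+* ℂ, ρ ∈ (Φ' 1).1 ↔ (ρ ∈ Φ.1 ∧ ρ ≠ ι₁) ∨ ρ = NumberField.ComplexEmbedding.conjugate ι₁) →
          c.IsSpecial ⟨J (fun i => ι₁ (w i)), hJC _ hw⟩ Φ') :
    ∃ E₀ : IntermediateField ℚ ℂ, FiniteDimensional ℚ ↥E₀ ∧ (∀ x : F, ι₁ x ∈ E₀) ∧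
      ∀ σ : ℂ ≃ₐ[ℚ] ℂ, (∀ x : ℂ, x ∈ E₀ → σ x = x) →
      ∀ s : (FiniteAdeleRing (𝓞 F) F)ˣ, IsArtinCorrespondent F ι₁ s σ.toRingEquiv →
      ∀ (w : Fin 2 → F) (hw : (fun i => ι₁ (w i)) ∈ negCone (Jstar.map ι₁))
        (d : ↥(finAdelic (↥(maximalRealSubfield F)) F (IsCMField.complexConj F) 2 Jstar)),
        IsDiagTwistGS F Jstar w (recipFactor F s) d →
      ∀ (a : ↥(finAdelic (↥(maximalRealSubfield F)) F (IsCMField.complexConj F) 2 Jstar))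
        (q : ↥(gspRational δ)) (J' : C0pm δ),
        conjJ (((gspRationalToReal δ q)⁻¹ : ↥(gspReal δ)) : GL (Fin g ⊕ Fin g) ℝ) (J (fun i => ι₁ (w i))) =
          (J' : Matrix (Fin g ⊕ Fin g) (Fin g ⊕ Fin g) ℝ) →
        ∃ (E : IntermediateField ℚ ℂ) (_ : NumberField ↥E) (c : CMStructure g δ (Fin 2) (fun _ => F)) (Φ' : Fin 2 → CMType F)
          (sE : (FiniteAdeleRing (𝓞 ↥E) ↥E)ˣ) (r : ↥(gspFinAdelic δ))
          (d' : ↥(finAdelic (↥(maximalRealSubfield F)) F (IsCMField.complexConj F) 2 Jstar)),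
          c.IsSpecial J' Φ' ∧ (∀ i, traceField (Φ' i) ≤ E) ∧ E ≤ E₀ ∧
          IsArtinCorrespondent ↥E (algebraMap ↥E ℂ) sE σ.toRingEquiv ∧
          ((r : GL (Fin g ⊕ Fin g) finAdeleQ) : Matrix (Fin g ⊕ Fin g) (Fin g ⊕ Fin g) finAdeleQ) = c.cmRecipMatrix Φ' E sE ∧
          SiegelShimuraSet.mk δ (principalLevelSubgroup δ N) J' (r * ((gspRationalToFinAdelic δ q)⁻¹ * auxToGspFinV Fr (a, 1))) =
            SiegelShimuraSet.mk δ (principalLevelSubgroup δ N) J' ((gspRationalToFinAdelic δ q)⁻¹ * auxToGspFinV Fr (d' * a, 1)) ∧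
          ∀ K : Subgroup ↥(finAdelic (↥(maximalRealSubfield F)) F (IsCMField.complexConj F) 2 Jstar),
            ShimuraSetGS.mk F Jstar ι₁ K (fun i => ι₁ (w i)) hw (d * a) = ShimuraSetGS.mk F Jstar ι₁ K (fun i => ι₁ (w i)) hw (d' * a) := by
  obtain ⟨E₀, hfd, hι₁E₀, hrecip⟩ := exists_sliceField_siegelRecipDatum ι₁ Jstar hJ Φ hΦ hN Fr J hJC hJsp
  refine ⟨E₀, hfd, hι₁E₀, fun σ hσ s hs w hw d hd a q J' hqJ => ?_⟩
  obtain ⟨E, hEnf, c, Φ', sE, r, d', hsp, hE, hEE₀, hsE, hr, hsiegel, hGS⟩ := hrecip σ hσ s hs w hw d hd a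
  haveI : NumberField ↥E := hEnf
  -- move the special pair and its reciprocity element along `q⁻¹`
  obtain ⟨c', -, hsp', hr'⟩ := CMStructure.IsSpecial.exists_inv_conj_recip_of_conjJ_eq c hsp q J' hqJ E sE r hr
  exact ⟨E, hEnf, c', Φ', sE, _, d', hsp', hE, hEE₀, hsE, hr',
    SiegelShimuraSet.mk_inv_conj_mul_inv_mul_eq_of_mk_mul_eq (principalLevelSubgroup δ N) q _ J' hqJ r _ _ hsiegel, hGS⟩

/-! ### §2. At Deligne's `J_Φ` of the curve: the special-pair clause discharged -/

/-- **THE SIEGEL RECIPROCITY DATUM OF A SPECIAL POINT OF THE CURVE AT `J_Φ(ι₁ w)`** — ★ `exists_sliceField_siegelRecipDatum` for E2's complex structure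
`J = auxComplexStructureV Fr ι₁ Φ`, its special-pair clause `hJsp` DISCHARGED by ★ `isSpecial_auxComplexStructureV_curve` ([Deligne1971TravauxShimura] 5.11: the
frame CM structure `c_b`, `b = (w′ | w)`, is special for `J_Φ(ι₁w)` with types `(Φ, Φ^ῑ₁)`).  This is the constructor-at-birth of the CM datum the E-line chart
owes the Σ-GAL socket (the `hsp hE σ s hs r hr` block of ★ `CMConjugationIsogenyAll` at `J(ι₁ w)`, over every slice field `Fᵢ ⊇ E₀`); `AuxChartGS.f_recip` is
its corollary through the carrier reciprocity of the Siegel fine moduli scheme (★ `exists_sliceField_f_recip`).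
[cite: Deligne1971TravauxShimura, 4.18 p. 150 and 5.11 p. 158] [cite: Milne2005ShimuraVarieties, Def. 12.5 p. 113, Def. 12.8 (59)–(62) p. 114, Ex. 12.4 (b) p. 112]
[cite: RapoportSmithlingZhang2020Diagonal, Remark 3.1 p. 9, (3.3), (3.10)] -/
theorem exists_sliceField_siegelRecipDatum_curve (ι₁ : F →+* ℂ) (Jstar : Matrix (Fin 2) (Fin 2) F)
    (hJ : (Jstar.map (IsCMField.complexConj F))ᵀ = Jstar) (Φ : CMType F) (hΦ : ι₁ ∈ Φ.1) {ξ : F} {g N : ℕ} {δ : Fin g → ℕ}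
    (hN : N ≠ 0) (Fr : SymplecticFrameV F (RingHom.id F) Jstar ξ g δ)
    (hJC : ∀ v : Fin 2 → ℂ, v ∈ negCone (Jstar.map ι₁) → auxComplexStructureV Fr ι₁ Φ v ∈ C0pm δ) :
    ∃ E₀ : IntermediateField ℚ ℂ, FiniteDimensional ℚ ↥E₀ ∧ (∀ x : F, ι₁ x ∈ E₀) ∧
      ∀ σ : ℂ ≃ₐ[ℚ] ℂ, (∀ x : ℂ, x ∈ E₀ → σ x = x) →
      ∀ s : (FiniteAdeleRing (𝓞 F) F)ˣ, IsArtinCorrespondent F ι₁ s σ.toRingEquiv →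
      ∀ (w : Fin 2 → F) (hw : (fun i => ι₁ (w i)) ∈ negCone (Jstar.map ι₁))
        (d : ↥(finAdelic (↥(maximalRealSubfield F)) F (IsCMField.complexConj F) 2 Jstar)),
        IsDiagTwistGS F Jstar w (recipFactor F s) d →
      ∀ a : ↥(finAdelic (↥(maximalRealSubfield F)) F (IsCMField.complexConj F) 2 Jstar),
        ∃ (E : IntermediateField ℚ ℂ) (_ : NumberField ↥E) (c : CMStructure g δ (Fin 2) (fun _ => F)) (Φ' : Fin 2 → CMType F)
          (sE : (FiniteAdeleRing (𝓞 ↥E) ↥E)ˣ) (r : ↥(gspFinAdelic δ))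
          (d' : ↥(finAdelic (↥(maximalRealSubfield F)) F (IsCMField.complexConj F) 2 Jstar)),
          c.IsSpecial ⟨auxComplexStructureV Fr ι₁ Φ (fun i => ι₁ (w i)), hJC _ hw⟩ Φ' ∧ (∀ i, traceField (Φ' i) ≤ E) ∧ E ≤ E₀ ∧
          IsArtinCorrespondent ↥E (algebraMap ↥E ℂ) sE σ.toRingEquiv ∧
          ((r : GL (Fin g ⊕ Fin g) finAdeleQ) : Matrix (Fin g ⊕ Fin g) (Fin g ⊕ Fin g) finAdeleQ) = c.cmRecipMatrix Φ' E sE ∧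
          SiegelShimuraSet.mk δ (principalLevelSubgroup δ N) ⟨auxComplexStructureV Fr ι₁ Φ (fun i => ι₁ (w i)), hJC _ hw⟩
              (r * auxToGspFinV Fr (a, 1)) =
            SiegelShimuraSet.mk δ (principalLevelSubgroup δ N) ⟨auxComplexStructureV Fr ι₁ Φ (fun i => ι₁ (w i)), hJC _ hw⟩
              (auxToGspFinV Fr (d' * a, 1)) ∧
          ∀ K : Subgroup ↥(finAdelic (↥(maximalRealSubfield F)) F (IsCMField.complexConj F) 2 Jstar),
            ShimuraSetGS.mk F Jstar ι₁ K (fun i => ι₁ (w i)) hw (d * a) = ShimuraSetGS.mk F Jstar ι₁ K (fun i => ι₁ (w i)) hw (d' * a) :=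
  exists_sliceField_siegelRecipDatum ι₁ Jstar hJ Φ hΦ hN Fr (auxComplexStructureV Fr ι₁ Φ) hJC
    (fun w hw b hb1 hperp c hc Φ' h0 h1 => isSpecial_auxComplexStructureV_curve ι₁ Jstar hJ Φ Fr hJC w hw b hb1 hperp c hc Φ' h0 h1)

/-- **THE SIEGEL RECIPROCITY DATUM OF A SPECIAL POINT OF THE CURVE AT THE CHART'S `J(Z a v) = q_ℝ⁻¹ · J_Φ(ι₁ w) · q_ℝ`** — §1 at E2's
`J = auxComplexStructureV Fr ι₁ Φ` with the special-pair clause discharged by ★ `isSpecial_auxComplexStructureV_curve`: the form in which the Σ-GAL socket of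
`stub_E6` consumes the CM datum (kernel markings `m₁` by `[J(Z a v), r]`, mover `q = q a` of `AuxChartGS.q_spec`).
[cite: Deligne1971TravauxShimura, Déf. 3.13 p. 141, 5.1 p. 153 and 5.11 p. 158] [cite: Milne2005ShimuraVarieties, Def. 12.8 (59)–(62) p. 114, Rem. 12.9 p. 115, Ex. 12.4 (b) p. 112]
[cite: RapoportSmithlingZhang2020Diagonal, Remark 3.1 p. 9 and (3.10)] -/
theorem exists_sliceField_siegelRecipDatum_curve_mover (ι₁ : F →+* ℂ) (Jstar : Matrix (Fin 2) (Fin 2) F)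
    (hJ : (Jstar.map (IsCMField.complexConj F))ᵀ = Jstar) (Φ : CMType F) (hΦ : ι₁ ∈ Φ.1) {ξ : F} {g N : ℕ} {δ : Fin g → ℕ}
    (hN : N ≠ 0) (Fr : SymplecticFrameV F (RingHom.id F) Jstar ξ g δ)
    (hJC : ∀ v : Fin 2 → ℂ, v ∈ negCone (Jstar.map ι₁) → auxComplexStructureV Fr ι₁ Φ v ∈ C0pm δ) :
    ∃ E₀ : IntermediateField ℚ ℂ, FiniteDimensional ℚ ↥E₀ ∧ (∀ x : F, ι₁ x ∈ E₀) ∧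
      ∀ σ : ℂ ≃ₐ[ℚ] ℂ, (∀ x : ℂ, x ∈ E₀ → σ x = x) →
      ∀ s : (FiniteAdeleRing (𝓞 F) F)ˣ, IsArtinCorrespondent F ι₁ s σ.toRingEquiv →
      ∀ (w : Fin 2 → F) (hw : (fun i => ι₁ (w i)) ∈ negCone (Jstar.map ι₁))
        (d : ↥(finAdelic (↥(maximalRealSubfield F)) F (IsCMField.complexConj F) 2 Jstar)),
        IsDiagTwistGS F Jstar w (recipFactor F s) d →
      ∀ (a : ↥(finAdelic (↥(maximalRealSubfield F)) F (IsCMField.complexConj F) 2 Jstar))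
        (q : ↥(gspRational δ)) (J' : C0pm δ),
        conjJ (((gspRationalToReal δ q)⁻¹ : ↥(gspReal δ)) : GL (Fin g ⊕ Fin g) ℝ) (auxComplexStructureV Fr ι₁ Φ (fun i => ι₁ (w i))) =
          (J' : Matrix (Fin g ⊕ Fin g) (Fin g ⊕ Fin g) ℝ) →
        ∃ (E : IntermediateField ℚ ℂ) (_ : NumberField ↥E) (c : CMStructure g δ (Fin 2) (fun _ => F)) (Φ' : Fin 2 → CMType F)
          (sE : (FiniteAdeleRing (𝓞 ↥E) ↥E)ˣ) (r : ↥(gspFinAdelic δ))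
          (d' : ↥(finAdelic (↥(maximalRealSubfield F)) F (IsCMField.complexConj F) 2 Jstar)),
          c.IsSpecial J' Φ' ∧ (∀ i, traceField (Φ' i) ≤ E) ∧ E ≤ E₀ ∧
          IsArtinCorrespondent ↥E (algebraMap ↥E ℂ) sE σ.toRingEquiv ∧
          ((r : GL (Fin g ⊕ Fin g) finAdeleQ) : Matrix (Fin g ⊕ Fin g) (Fin g ⊕ Fin g) finAdeleQ) = c.cmRecipMatrix Φ' E sE ∧
          SiegelShimuraSet.mk δ (principalLevelSubgroup δ N) J' (r * ((gspRationalToFinAdelic δ q)⁻¹ * auxToGspFinV Fr (a, 1))) =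
            SiegelShimuraSet.mk δ (principalLevelSubgroup δ N) J' ((gspRationalToFinAdelic δ q)⁻¹ * auxToGspFinV Fr (d' * a, 1)) ∧
          ∀ K : Subgroup ↥(finAdelic (↥(maximalRealSubfield F)) F (IsCMField.complexConj F) 2 Jstar),
            ShimuraSetGS.mk F Jstar ι₁ K (fun i => ι₁ (w i)) hw (d * a) = ShimuraSetGS.mk F Jstar ι₁ K (fun i => ι₁ (w i)) hw (d' * a) :=
  exists_sliceField_siegelRecipDatum_mover ι₁ Jstar hJ Φ hΦ hN Fr (auxComplexStructureV Fr ι₁ Φ) hJC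
    (fun w hw b hb1 hperp c hc Φ' h0 h1 => isSpecial_auxComplexStructureV_curve ι₁ Jstar hJ Φ Fr hJC w hw b hb1 hperp c hc Φ' h0 h1)

/-! ### §3 (ED. 2). The EXPLICIT twist identity `r·ũ(a,1) = ũ(d♯a,1)·t`, `t ∈ K_δ(N)` (★ E3R-U ED. 2 `exists_sliceField_siegelRecipDatum_explicit`, LA6-p02),
moved: `r′·(q_𝔸⁻¹ũ(a,1)) = (q_𝔸⁻¹ũ(d♯a,1))·t` — the operand shape of ★ `F0P6aCMHomKernelShape.exists_cmConjHom_kernelShape` (`rcm * ah = b₂ * t`) -/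

/-- group algebra: `r·a₁ = a₂·t ⇒ (q⁻¹ r q)·(q⁻¹ a₁) = (q⁻¹ a₂)·t`. [folklore] -/
private theorem inv_conj_mul_inv_mul_eq_of_mul_eq {G : Type} [Group G] (q r a₁ a₂ t : G) (h : r * a₁ = a₂ * t) :
    q⁻¹ * r * q * (q⁻¹ * a₁) = q⁻¹ * a₂ * t := by
  rw [show q⁻¹ * r * q * (q⁻¹ * a₁) = q⁻¹ * (r * a₁) by group, h, mul_assoc]

/-- **THE SIEGEL RECIPROCITY DATUM AT THE MOVED COMPLEX STRUCTURE, EXPLICIT TWIST IDENTITY** — §1 `exists_sliceField_siegelRecipDatum_mover` with the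
Siegel class identity replaced by the GROUP identity `r′ · (q_𝔸⁻¹·ũ_V(a,1)) = (q_𝔸⁻¹·ũ_V(d♯·a,1)) · t` for some `t ∈ K_δ(N)` (`r′ = q_𝔸⁻¹ r q_𝔸` has matrix
`c′.cmRecipMatrix Φ′ E s♯` for the moved special pair `(c′, J′)`; ★ E3R-U ED. 2 `exists_sliceField_siegelRecipDatum_explicit` ∘ ★
`CMStructure.IsSpecial.exists_inv_conj_recip_of_conjJ_eq`).  This is the operand shape `rcm * ah = b₂ * t` of ★ `F0P6aCMHomKernelShape.exists_cmConjHom_kernelShape`.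
[cite: Deligne1971TravauxShimura, Déf. 3.13 p. 141, 5.1 p. 153 and 5.11 p. 158] [cite: Milne2005ShimuraVarieties, Def. 12.8 (59)–(62) p. 114, Rem. 12.9 p. 115]
[cite: RapoportSmithlingZhang2020Diagonal, Remark 3.1 p. 9 and (3.10)] -/
theorem exists_sliceField_siegelRecipDatum_mover_explicit (ι₁ : F →+* ℂ) (Jstar : Matrix (Fin 2) (Fin 2) F)
    (hJ : (Jstar.map (IsCMField.complexConj F))ᵀ = Jstar) (Φ : CMType F) (hΦ : ι₁ ∈ Φ.1) {ξ : F} {g N : ℕ} {δ : Fin g → ℕ}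
    (hN : N ≠ 0) (Fr : SymplecticFrameV F (RingHom.id F) Jstar ξ g δ)
    (J : (Fin 2 → ℂ) → Matrix (Fin g ⊕ Fin g) (Fin g ⊕ Fin g) ℝ)
    (hJC : ∀ v : Fin 2 → ℂ, v ∈ negCone (Jstar.map ι₁) → J v ∈ C0pm δ)
    (hJsp : ∀ (w : Fin 2 → F) (hw : (fun i => ι₁ (w i)) ∈ negCone (Jstar.map ι₁)) (b : GL (Fin 2) F),
      (fun i => (b : Matrix (Fin 2) (Fin 2) F) i 1) = w →
      hermForm (cmConjRingHom F) Jstar (fun i => (b : Matrix (Fin 2) (Fin 2) F) i 0) w = 0 →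
      ∀ c : CMStructure g δ (Fin 2) (fun _ => F),
        (∀ (x : Fin 2 → F) (p : Fin 2) (m : F),
          c.act x (Fr.β (m • (b : Matrix (Fin 2) (Fin 2) F) *ᵥ Pi.single p 1)) =
            Fr.β ((x p * m) • (b : Matrix (Fin 2) (Fin 2) F) *ᵥ Pi.single p 1)) →
        ∀ Φ' : Fin 2 → CMType F, Φ' 0 = Φ →
          (∀ ρ : F →+* ℂ, ρ ∈ (Φ' 1).1 ↔ (ρ ∈ Φ.1 ∧ ρ ≠ ι₁) ∨ ρ = NumberField.ComplexEmbedding.conjugate ι₁) →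
          c.IsSpecial ⟨J (fun i => ι₁ (w i)), hJC _ hw⟩ Φ') :
    ∃ E₀ : IntermediateField ℚ ℂ, FiniteDimensional ℚ ↥E₀ ∧ (∀ x : F, ι₁ x ∈ E₀) ∧
      ∀ σ : ℂ ≃ₐ[ℚ] ℂ, (∀ x : ℂ, x ∈ E₀ → σ x = x) →
      ∀ s : (FiniteAdeleRing (𝓞 F) F)ˣ, IsArtinCorrespondent F ι₁ s σ.toRingEquiv →
      ∀ (w : Fin 2 → F) (hw : (fun i => ι₁ (w i)) ∈ negCone (Jstar.map ι₁))
        (d : ↥(finAdelic (↥(maximalRealSubfield F)) F (IsCMField.complexConj F) 2 Jstar)),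
        IsDiagTwistGS F Jstar w (recipFactor F s) d →
      ∀ (a : ↥(finAdelic (↥(maximalRealSubfield F)) F (IsCMField.complexConj F) 2 Jstar))
        (q : ↥(gspRational δ)) (J' : C0pm δ),
        conjJ (((gspRationalToReal δ q)⁻¹ : ↥(gspReal δ)) : GL (Fin g ⊕ Fin g) ℝ) (J (fun i => ι₁ (w i))) =
          (J' : Matrix (Fin g ⊕ Fin g) (Fin g ⊕ Fin g) ℝ) →
        ∃ (E : IntermediateField ℚ ℂ) (_ : NumberField ↥E) (c : CMStructure g δ (Fin 2) (fun _ => F)) (Φ' : Fin 2 → CMType F)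
          (sE : (FiniteAdeleRing (𝓞 ↥E) ↥E)ˣ) (r : ↥(gspFinAdelic δ))
          (d' : ↥(finAdelic (↥(maximalRealSubfield F)) F (IsCMField.complexConj F) 2 Jstar)),
          c.IsSpecial J' Φ' ∧ (∀ i, traceField (Φ' i) ≤ E) ∧ E ≤ E₀ ∧
          IsArtinCorrespondent ↥E (algebraMap ↥E ℂ) sE σ.toRingEquiv ∧
          ((r : GL (Fin g ⊕ Fin g) finAdeleQ) : Matrix (Fin g ⊕ Fin g) (Fin g ⊕ Fin g) finAdeleQ) = c.cmRecipMatrix Φ' E sE ∧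
          (∃ t ∈ principalLevelSubgroup δ N,
            r * ((gspRationalToFinAdelic δ q)⁻¹ * auxToGspFinV Fr (a, 1)) = (gspRationalToFinAdelic δ q)⁻¹ * auxToGspFinV Fr (d' * a, 1) * t) ∧
          ∀ K : Subgroup ↥(finAdelic (↥(maximalRealSubfield F)) F (IsCMField.complexConj F) 2 Jstar),
            ShimuraSetGS.mk F Jstar ι₁ K (fun i => ι₁ (w i)) hw (d * a) = ShimuraSetGS.mk F Jstar ι₁ K (fun i => ι₁ (w i)) hw (d' * a) := by
  obtain ⟨E₀, hfd, hι₁E₀, hrecip⟩ := exists_sliceField_siegelRecipDatum_explicit ι₁ Jstar hJ Φ hΦ hN Fr J hJC hJsp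
  refine ⟨E₀, hfd, hι₁E₀, fun σ hσ s hs w hw d hd a q J' hqJ => ?_⟩
  obtain ⟨E, hEnf, c, Φ', sE, r, d', hsp, hE, hEE₀, hsE, hr, ⟨t, ht, hsiegel⟩, hGS⟩ := hrecip σ hσ s hs w hw d hd a
  haveI : NumberField ↥E := hEnf
  -- move the special pair and its reciprocity element along `q⁻¹`
  obtain ⟨c', -, hsp', hr'⟩ := CMStructure.IsSpecial.exists_inv_conj_recip_of_conjJ_eq c hsp q J' hqJ E sE r hr
  exact ⟨E, hEnf, c', Φ', sE, _, d', hsp', hE, hEE₀, hsE, hr',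
    ⟨t, ht, inv_conj_mul_inv_mul_eq_of_mul_eq (gspRationalToFinAdelic δ q) r _ _ t hsiegel⟩, hGS⟩

/-- **THE SIEGEL RECIPROCITY DATUM OF A SPECIAL POINT OF THE CURVE AT `J_Φ(ι₁ w)`, EXPLICIT TWIST IDENTITY** — ★ E3R-U ED. 2
`exists_sliceField_siegelRecipDatum_explicit` at E2's `J = auxComplexStructureV Fr ι₁ Φ` with the special-pair clause DISCHARGED by ★
`isSpecial_auxComplexStructureV_curve` (the un-moved constructor-at-birth of the ED. 5 CM-datum field, explicit form `r·ũ_V(a,1) = ũ_V(d♯·a,1)·t`).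
[cite: Deligne1971TravauxShimura, 4.18 p. 150 and 5.11 p. 158] [cite: Milne2005ShimuraVarieties, Def. 12.5 p. 113, Def. 12.8 (59)–(62) p. 114, Ex. 12.4 (b) p. 112]
[cite: RapoportSmithlingZhang2020Diagonal, Remark 3.1 p. 9, (3.3), (3.10)] -/
theorem exists_sliceField_siegelRecipDatum_curve_explicit (ι₁ : F →+* ℂ) (Jstar : Matrix (Fin 2) (Fin 2) F)
    (hJ : (Jstar.map (IsCMField.complexConj F))ᵀ = Jstar) (Φ : CMType F) (hΦ : ι₁ ∈ Φ.1) {ξ : F} {g N : ℕ} {δ : Fin g → ℕ}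
    (hN : N ≠ 0) (Fr : SymplecticFrameV F (RingHom.id F) Jstar ξ g δ)
    (hJC : ∀ v : Fin 2 → ℂ, v ∈ negCone (Jstar.map ι₁) → auxComplexStructureV Fr ι₁ Φ v ∈ C0pm δ) :
    ∃ E₀ : IntermediateField ℚ ℂ, FiniteDimensional ℚ ↥E₀ ∧ (∀ x : F, ι₁ x ∈ E₀) ∧
      ∀ σ : ℂ ≃ₐ[ℚ] ℂ, (∀ x : ℂ, x ∈ E₀ → σ x = x) →
      ∀ s : (FiniteAdeleRing (𝓞 F) F)ˣ, IsArtinCorrespondent F ι₁ s σ.toRingEquiv →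
      ∀ (w : Fin 2 → F) (hw : (fun i => ι₁ (w i)) ∈ negCone (Jstar.map ι₁))
        (d : ↥(finAdelic (↥(maximalRealSubfield F)) F (IsCMField.complexConj F) 2 Jstar)),
        IsDiagTwistGS F Jstar w (recipFactor F s) d →
      ∀ a : ↥(finAdelic (↥(maximalRealSubfield F)) F (IsCMField.complexConj F) 2 Jstar),
        ∃ (E : IntermediateField ℚ ℂ) (_ : NumberField ↥E) (c : CMStructure g δ (Fin 2) (fun _ => F)) (Φ' : Fin 2 → CMType F)
          (sE : (FiniteAdeleRing (𝓞 ↥E) ↥E)ˣ) (r : ↥(gspFinAdelic δ))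
          (d' : ↥(finAdelic (↥(maximalRealSubfield F)) F (IsCMField.complexConj F) 2 Jstar)),
          c.IsSpecial ⟨auxComplexStructureV Fr ι₁ Φ (fun i => ι₁ (w i)), hJC _ hw⟩ Φ' ∧ (∀ i, traceField (Φ' i) ≤ E) ∧ E ≤ E₀ ∧
          IsArtinCorrespondent ↥E (algebraMap ↥E ℂ) sE σ.toRingEquiv ∧
          ((r : GL (Fin g ⊕ Fin g) finAdeleQ) : Matrix (Fin g ⊕ Fin g) (Fin g ⊕ Fin g) finAdeleQ) = c.cmRecipMatrix Φ' E sE ∧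
          (∃ t ∈ principalLevelSubgroup δ N, r * auxToGspFinV Fr (a, 1) = auxToGspFinV Fr (d' * a, 1) * t) ∧
          ∀ K : Subgroup ↥(finAdelic (↥(maximalRealSubfield F)) F (IsCMField.complexConj F) 2 Jstar),
            ShimuraSetGS.mk F Jstar ι₁ K (fun i => ι₁ (w i)) hw (d * a) = ShimuraSetGS.mk F Jstar ι₁ K (fun i => ι₁ (w i)) hw (d' * a) :=
  exists_sliceField_siegelRecipDatum_explicit ι₁ Jstar hJ Φ hΦ hN Fr (auxComplexStructureV Fr ι₁ Φ) hJC
    (fun w hw b hb1 hperp c hc Φ' h0 h1 => isSpecial_auxComplexStructureV_curve ι₁ Jstar hJ Φ Fr hJC w hw b hb1 hperp c hc Φ' h0 h1)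

/-- **THE SIEGEL RECIPROCITY DATUM OF A SPECIAL POINT OF THE CURVE AT THE CHART'S `J(Z a v)`, EXPLICIT TWIST IDENTITY** — the `_mover_explicit` head at
E2's `J = auxComplexStructureV Fr ι₁ Φ`, special-pair clause discharged by ★ `isSpecial_auxComplexStructureV_curve`.
[cite: Deligne1971TravauxShimura, Déf. 3.13 p. 141, 5.1 p. 153 and 5.11 p. 158] [cite: Milne2005ShimuraVarieties, Def. 12.8 (59)–(62) p. 114, Rem. 12.9 p. 115, Ex. 12.4 (b) p. 112]
[cite: RapoportSmithlingZhang2020Diagonal, Remark 3.1 p. 9 and (3.10)] -/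
theorem exists_sliceField_siegelRecipDatum_curve_mover_explicit (ι₁ : F →+* ℂ) (Jstar : Matrix (Fin 2) (Fin 2) F)
    (hJ : (Jstar.map (IsCMField.complexConj F))ᵀ = Jstar) (Φ : CMType F) (hΦ : ι₁ ∈ Φ.1) {ξ : F} {g N : ℕ} {δ : Fin g → ℕ}
    (hN : N ≠ 0) (Fr : SymplecticFrameV F (RingHom.id F) Jstar ξ g δ)
    (hJC : ∀ v : Fin 2 → ℂ, v ∈ negCone (Jstar.map ι₁) → auxComplexStructureV Fr ι₁ Φ v ∈ C0pm δ) :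
    ∃ E₀ : IntermediateField ℚ ℂ, FiniteDimensional ℚ ↥E₀ ∧ (∀ x : F, ι₁ x ∈ E₀) ∧
      ∀ σ : ℂ ≃ₐ[ℚ] ℂ, (∀ x : ℂ, x ∈ E₀ → σ x = x) →
      ∀ s : (FiniteAdeleRing (𝓞 F) F)ˣ, IsArtinCorrespondent F ι₁ s σ.toRingEquiv →
      ∀ (w : Fin 2 → F) (hw : (fun i => ι₁ (w i)) ∈ negCone (Jstar.map ι₁))
        (d : ↥(finAdelic (↥(maximalRealSubfield F)) F (IsCMField.complexConj F) 2 Jstar)),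
        IsDiagTwistGS F Jstar w (recipFactor F s) d →
      ∀ (a : ↥(finAdelic (↥(maximalRealSubfield F)) F (IsCMField.complexConj F) 2 Jstar))
        (q : ↥(gspRational δ)) (J' : C0pm δ),
        conjJ (((gspRationalToReal δ q)⁻¹ : ↥(gspReal δ)) : GL (Fin g ⊕ Fin g) ℝ) (auxComplexStructureV Fr ι₁ Φ (fun i => ι₁ (w i))) =
          (J' : Matrix (Fin g ⊕ Fin g) (Fin g ⊕ Fin g) ℝ) →
        ∃ (E : IntermediateField ℚ ℂ) (_ : NumberField ↥E) (c : CMStructure g δ (Fin 2) (fun _ => F)) (Φ' : Fin 2 → CMType F)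
          (sE : (FiniteAdeleRing (𝓞 ↥E) ↥E)ˣ) (r : ↥(gspFinAdelic δ))
          (d' : ↥(finAdelic (↥(maximalRealSubfield F)) F (IsCMField.complexConj F) 2 Jstar)),
          c.IsSpecial J' Φ' ∧ (∀ i, traceField (Φ' i) ≤ E) ∧ E ≤ E₀ ∧
          IsArtinCorrespondent ↥E (algebraMap ↥E ℂ) sE σ.toRingEquiv ∧
          ((r : GL (Fin g ⊕ Fin g) finAdeleQ) : Matrix (Fin g ⊕ Fin g) (Fin g ⊕ Fin g) finAdeleQ) = c.cmRecipMatrix Φ' E sE ∧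
          (∃ t ∈ principalLevelSubgroup δ N,
            r * ((gspRationalToFinAdelic δ q)⁻¹ * auxToGspFinV Fr (a, 1)) = (gspRationalToFinAdelic δ q)⁻¹ * auxToGspFinV Fr (d' * a, 1) * t) ∧
          ∀ K : Subgroup ↥(finAdelic (↥(maximalRealSubfield F)) F (IsCMField.complexConj F) 2 Jstar),
            ShimuraSetGS.mk F Jstar ι₁ K (fun i => ι₁ (w i)) hw (d * a) = ShimuraSetGS.mk F Jstar ι₁ K (fun i => ι₁ (w i)) hw (d' * a) :=
  exists_sliceField_siegelRecipDatum_mover_explicit ι₁ Jstar hJ Φ hΦ hN Fr (auxComplexStructureV Fr ι₁ Φ) hJC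
    (fun w hw b hb1 hperp c hc Φ' h0 h1 => isSpecial_auxComplexStructureV_curve ι₁ Jstar hJ Φ Fr hJC w hw b hb1 hperp c hc Φ' h0 h1)

end AuxV

end UnitaryCurve

end Literature.AlgebraicGeometry.ShimuraVarieties

end
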